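import Summits.ResolutionOfSingularities.ResolutionOfSingularities.Theorems.FrobeniusClosingPatchingRelPerfectDepthWeightTwoBNrFront
import Summits.ResolutionOfSingularities.ResolutionOfSingularities.Theorems.FrobeniusClosingPatchingRelPerfectDepthWeightTwoBNrEndPackage
import Summits.ResolutionOfSingularities.ResolutionOfSingularities.Theorems.FrobeniusClosingPatchingRelPerfectDepthWeightTwoBPeelLoop
import Summits.ResolutionOfSingularities.ResolutionOfSingularities.Theorems.FrobeniusClosingPatchingRelPerfectDepthMixedTargetsJRnr
import HarnessLib

/-!
# Crux `PatchingRelPerfect` (stmt-ResolutionOfSingularities-16161), chain W5.2 — F5c: TARGET T5-E^nr `WeightTwoBoundaryJRnr₃`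
# CLOSED BY NAME — `DepthTargets.weightTwoBoundaryJRnr₃_holds`

[OURS · L1 W5.2 · TargetsF5c v1.0 (res-L1-w52-plan-1; tree module `…DepthMixedTargetsJRnr` p527093, filer res-type-003); owner
res-D-pv-052 AS res-L1-w52-stub-7 (STEER 4/5).]  NOT statements of the manuscript under review (Hironaka 2017); AI-produced composition
of kernel-checked theorems, weaker than expert review.  The F-32bR named fact `CossartJannsenSaito2020EmbeddedSequenceB` occurs ONLY as
the antecedent INSIDE the target — a hypothesis, never asserted.

THE COMPOSITION (design «(J#) carries the invariant», owner's cut 2026-08-27T11:17:08Z):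
* FRONT `WeightTwoB.Nr.transport_cjs_end` (p529705): F-32bR's embedded sequence over `Supp 𝔟` transported WITHOUT reducedness
  (`WeightTwoB.Nr.cjs_transport` p529202 over `StateNr` p527818 / `Nr.stateNr'` p528744 — res-D-pv-054's T5-E transport with the
  reduced-host clause deleted) — an `IsWeightedSeqJR 2` sequence from `(𝔟, 𝔟, [], [])` to a state `StateNr 𝔟' D' ℬ' 𝒟'` on `E' ≅ Z₁`
  plus the CJS end clauses;
* END PACKAGE `WeightTwoB.StateNr.endPackage` (res-D-pv-055, p529694): the final host FACTORISES into its regular, pairwise disjoint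
  components with exponents, inside ONE snc family with the boundary, components of exponent `≥ 2` disjoint from the N-charged members
  ((J#) ⇒ exponent one);
* PEEL LOOP `DepthSep.exists_endStateJR_of_factorised` (res-L1-w52-stub-1, p529458 over `isWeightedSeqJR_peel` p527073): one weight-two
  peel along `𝟙 E'` per component of exponent `≥ 2`, then `EndStateJR`.

RUNG (CHAIN v2.2 §3 «R4ˢ-principal»): with `weightTwoBoundaryJRnr₃_holds` the record `…DepthOneFormGradedRecordNr` (res-type-003 p527881:
`gradedHostMember_atomConclusion_two_nr_of_eside`, `oneFormGradedMember_atomConclusion_nr_of_eside`) discharges `hW` — every depth-two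
GRADED member of the four-dimensional regular local ring with non-zero LOCALLY PRINCIPAL form ideal sheaf (every graded one-form, ANY
form) is in 𝒞 modulo F-32bR; and `weightTwoBoundaryJR₃_of_nr weightTwoBoundaryJRnr₃_holds : WeightTwoBoundaryJR₃` re-closes T5-E by name
(not restated here: res-D-pv-054's `weightTwoBoundaryJR₃_holds` is the landed closer of that statement).

## References
* V. Cossart, U. Jannsen, S. Saito, *Desingularization: invariants and strategy*, LNM 2270 (2020), Thm. 1.4, Def. 3.1, Def. 4.1. [CossartJannsenSaito2020]
* E. Bierstone, D. Grigoriev, P. Milman, J. Włodarczyk, arXiv:1206.3090, Def. 3.1.3, §3.2 Lemma 3.2.1, §4 Step 2. [BierstoneGrigorievMilmanWlodarczyk2011]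
* J. Kollár, *Lectures on Resolution of Singularities* (2007), (3.111) Steps 1–3, 3.30.2. [Kollar2007]
-/

-- `Summit.<Summit>.<Sub>.Theorems` with `Sub = Summit` (single-conjunct summit, D-0017)
set_option linter.dupNamespace false

noncomputable section

open CategoryTheory CategoryTheory.Limits AlgebraicGeometry TopologicalSpace IsLocalRing
open Literature.AlgebraicGeometry.Resolution Scheme.IdealSheafData

namespace Summit.ResolutionOfSingularities.ResolutionOfSingularities.Theorems

universe u

namespace WeightTwoB

namespace Nr

open DepthSNC DepthTargets

/-- [OURS · L1 W5.2 · F5c] **`WeightTwoBoundaryJRnr₃` BY CONTENT**: modulo CJS (F-32bR, a hypothesis), every non-zero locally principal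
`𝔟` on an integral Noetherian regular excellent scheme of dimension three — NO reducedness assumed — is carried by an `IsWeightedSeqJR 2`
sequence from `(𝔟, 𝔟, [], [])` to an `EndStateJR` datum on an integral Noetherian regular scheme: front (transport) + end package
(factorisation) + peel loop. [cite: CossartJannsenSaito2020, Thm. 1.4] [cite: Kollar2007, (3.111) Steps 1–3]
[cite: BierstoneGrigorievMilmanWlodarczyk2011, §4 Step 2] -/
theorem weightTwoBoundaryJRnr (hCJS : CossartJannsenSaito2020EmbeddedSequenceB.{u})
    (E : Scheme.{u}) [IsIntegral E] [IsNoetherian E] (hreg : Scheme.IsRegular E) (hexc : Scheme.IsExcellent E)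
    (hdim : topologicalKrullDim E = 3) (𝔟 : E.IdealSheafData) (h𝔟 : 𝔟 ≠ ⊥) (hlp : IsLocallyPrincipal 𝔟) :
    ∃ (E' : Scheme.{u}) (ρ : E' ⟶ E) (𝔟' D' : E'.IdealSheafData) (ℬ' 𝒟' : List (E'.IdealSheafData × ℕ)),
      IsWeightedSeqJR 2 ρ 𝔟 𝔟 [] [] 𝔟' D' ℬ' 𝒟' ∧ IsIntegral E' ∧ IsNoetherian E' ∧ Scheme.IsRegular E' ∧
        EndStateJR 𝔟' D' ℬ' := by
  -- FRONT: CJS + the reducedness-free transport, with the CJS end clauses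
  obtain ⟨Z₁, X₁, B₁, E', hint, hnoeth, hnoethZ, ρ, e, 𝔟', D', ℬ', 𝒟', hseq, S, hX₁c, hX₁, htr, hsupp, hbd⟩ :=
    transport_cjs_end hCJS E hreg hexc hdim 𝔟 h𝔟 hlp
  haveI := hint
  haveI := hnoeth
  haveI := hnoethZ
  -- END PACKAGE: the final host factorised inside one snc family with the boundary
  obtain ⟨𝓟, hD, hpos, -, hsnc, hmem, hdisj, -, -, hN, -⟩ := S.endPackage e hX₁c hX₁ htr hsupp hbd
  subst hD
  -- PEEL LOOP: one weight-two peel per multiple component, then the end state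
  obtain ⟨ρ'', 𝔟'', D'', ℬ'', 𝒟'', hseq'', hend⟩ :=
    DepthSep.exists_endStateJR_of_factorised hsnc 𝓟 (fun p hp => List.mem_append_left _ (List.mem_map.mpr ⟨p, hp, rfl⟩)) hpos
      (fun p hp => (hmem p hp).1) hdisj (fun B hB => List.mem_append_right _ hB) (fun p hp => (hmem p hp).2.2.2.2.2.1)
      (fun q hq hq0 p hp hp2 => hN p hp hp2 q hq hq0) hseq
  exact ⟨E', ρ'', 𝔟'', D'', ℬ'', 𝒟'', hseq'', hint, hnoeth, S.regW, hend⟩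

end Nr

end WeightTwoB

namespace DepthTargets

/-- **TARGET T5-E^nr «W₂B without reducedness» BY NAME** (`WeightTwoBoundaryJRnr₃`, TargetsF5c v1.0 of record): see
`WeightTwoB.Nr.weightTwoBoundaryJRnr`. [cite: CossartJannsenSaito2020, Thm. 1.4] [cite: Kollar2007, (3.111) Steps 1–3] -/
theorem weightTwoBoundaryJRnr₃_holds : WeightTwoBoundaryJRnr₃.{u} := by
  intro hCJS E _ _ hreg hexc hdim 𝔟 h𝔟 hlp
  exact WeightTwoB.Nr.weightTwoBoundaryJRnr hCJS E hreg hexc hdim 𝔟 h𝔟 hlp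

end DepthTargets

end Summit.ResolutionOfSingularities.ResolutionOfSingularities.Theorems

end
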